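import Summits.AtomisticToContinuum.Crystallization.Theses.ReggeStarCoercivity
import Summits.AtomisticToContinuum.Crystallization.Theorems.DefectFreeCrystallizes.Negative.PredicateAPI
import Summits.AtomisticToContinuum.Crystallization.Theorems.DefectFreeCrystallizes.Negative.TypeGap
import Summits.AtomisticToContinuum.Crystallization.Theorems.DefectFreeCrystallizes.Negative.StrainBlindness
import Literature.MathematicalPhysics.StatisticalMechanics.BarlowStacking
import Literature.MathematicalPhysics.StatisticalMechanics.MuGroundStateConfiguration
import Literature.MathematicalPhysics.StatisticalMechanics.LennardJonesClusters

/-!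
# Line `octet-cell-squeeze` — skeleton for crux `DefectFreeCrystallizes` (stmt-AtomisticToContinuum-13603), gen 2

Crux (route `ReggeStarCoercivity`, rank 5): `DefectFreeCrystallizes := ZeroDefectDensity → IsCrystallizing
lennardJones 3` — along every sequence of Lennard-Jones ground states whose fraction of `1/20`-defective first
shells tends to `0`, some translated subsequence converges locally to a non-zero periodic point measure.

## The line (idea card `Ideas/octet-cell-squeeze.md`, ideator 3; triage r1: pass ×3)

Around a first-shell-good site the tetrahedron/octahedron cell complex of a close packing exists combinatorially
(STUB `stub_localCellComplex`: one consistent finite family of 6-vertex cells).  Tetrahedra are affinely trivial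
and carry no functional; every nearest-neighbour bond is given half-and-half to the TWO octahedra it borders and
every `√2`-bond to the ONE octahedron whose diagonal it is (`PhiOct`), so `Σ_oct PhiOct` is the bond energy out to
`√2·a`.  Three slack terms, each a certified inequality over existing declarations, are squeezed against ONE
cut-and-paste upper bound per ball:

* non-affinity of a cell — `stub_octahedronCoercivity`: (a) the 18-dimensional inner-band certificate (gain
  `≥ 1·Σ‖vᵢ‖²` within radius `a/9` of the affine cell `a(1+E)`, `a ∈ [19/20, 1]`, `‖E‖ ≤ 1/50`; reduced Hessian
  `{3, 9}` at `a = 1`, `{4.759, 15.729}` at `a* = 0.9712`; worst nonlinear gain ratio `1.11` at the corner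
  `(1, +I/50)`) and (b) the OUTER HAND-OVER: on the whole near-conformal band the non-affine DEFICIT of a cell is at
  most half the landscape slack of the same strain (worst found ratio `0.29` of the allowed `1/2`, at 20 % shear
  anisotropy; zero deficit up to 12.5 % anisotropy and up to edge `1.107`);
* strain of a cell away from the relaxed hcp metric, for EVERY Hägg word — `stub_bandLandscape`: a band minimiser
  `G₀` of the hcp strain landscape `W` exists, is realised by a periodic configuration, and EVERY site of EVERY
  affinely strained Barlow stacking `G·barlowStacking s` with `G` in the band lies at least
  `(3/4)·min(‖GᵀG − G₀ᵀG₀‖², 6/1000)` above `W G₀` (lattice sums: 0 violations over 2637 (strain, word) pairs,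
  worst ratio `1.48`; relaxed hcp `a* = 0.9713`, `h*/a* = 0.8164`, `W G₀ = −0.71759`);
* a cubic registry letter seen by a site — `stub_registryGap`: within `3 %` of `G₀` a cubic-sighted site pays an
  extra `10⁻⁵` on top of the quadratic strain slack (`½|J₂| − ½|J₃| = 3.68e-5` at `G₀`, margin `3.7×`; the
  first-order shear–registry coupling vanishes by the 3-fold symmetry of the hole point and the cubic one,
  `≈ 5.9·(γh)³`, is dominated by the elastic `1.34 γ²` up to `γ ≈ 0.4`);

and `stub_windowPinning` is the one-sided pinning `self(W) ≤ n·e(Q) + C_Q R²` for ground states against ANY fixed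
periodic trial configuration `Q` (exact minimality enters here and only here — the Disproof's gen-1 load-bearing
verdict).  `stub_squeeze` is the analysis (far-field path absorption, boundary flux `O(R²·max dev)`, Chebyshev
sub-balls, chaining of cell frames): from the five inputs, every large all-good ball of a ground state contains an
`r`-sub-ball two-way `ε`-matched to a rigid image of ONE strained hcp `G₀·hcp` (`SqueezeWindow`, finite `N`,
uniform in `N`).  `stub_transfer` turns `SqueezeWindow` + zero defect density into `IsCrystallizing`.
`DefectFreeCrystallizes_of` composes the seven stubs into the route decl BY NAME (kernel-checked, no `sorry`).

## What generation 2 changed (numerics: line card `Lines/octet-cell-squeeze.md`, folder `calc/`)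

* gen-1 `StrainLandscape` pinned a GLOBAL modulus `½` in `‖GᵀG − G₀ᵀG₀‖²`: FALSE in band (uniaxial in-plane
  stretch to singular value `1.2`: slack `0.107 < 0.123`; ratio `0.87`).  Replaced by the two-regime growth
  `(3/4)·min(‖ΔC‖², 6/1000)` stated for ALL words (`BandLandscape`), verified band-wide.
* gen-1 `RegistryLandscape` (radius `3 %`, `γ′ = 10⁻⁵`) survives the cubic shear–registry check and is kept as
  `RegistryGap` with the quadratic slack added (verified jointly); word-dependence OUTSIDE `3 %` (up to `4e-2` per
  site at 25 % basal shear, not `≤ 2e-4`) is now covered by `BandLandscape`, which gen 1 left untyped.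
* gen-1 `LocalCellStar` ended with a universal UNIQUENESS clause over all cell readings through a site; exact fcc
  has 36 further centrally symmetric lattice octahedra through every site (anisotropy `2`, centred at bond
  midpoints), excluded only quantitatively.  Replaced by `LocalCellComplex`: EXISTENCE of one consistent cell
  family (what the squeeze consumes), with near-conformal readings (`‖GᵀG − c‖ ≤ c/5`, the strain-blindness
  window of `Negative.StrainBlindness` being `≈ 1/10` per mechanism).
* gen-1 `OctahedronCoercivity` covered only the inner tube; sheared band cells have reduced curvature down to
  `−2.0` (20 % shear) and the typed inputs gave the squeeze no control there.  Clause (b) added.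

Disproof used (`Cruxes/DefectFreeCrystallizes/Disproof.lean`, gen 2 v10): no `_false_without_` theorem exists;
the gen-1 load-bearing verdict (geometric bridge without ground states REFUTED by the 2-adic Hägg stacking ⇒
exact minimality must select strain AND stacking) is honoured at `stub_windowPinning`/`stub_squeeze`
(`IsGroundState` is consumed there); §3 `good_not_closed` is moot because no statement below passes `Good` to a
limit (windows are finite-`N` matching statements); §4 `Negative.TypeGap.not_fccClose_and_hcpClose` and §6
`Negative.StrainBlindness` (window `[19/21, 21/19]`, shears `≤ 0.11`) are imported and fix the band `[17/20, 6/5]`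
of `InBand` and the anisotropy `1/5` of `NearConformal`; §2 radial pinning (`PredicateAPI.Good.exists_annulus`)
is the first step of `stub_localCellComplex`.  Negatives 4146 / 3506 untouched (pattern closeness is INPUT; no
finite-N gluing).
-/

noncomputable section

open scoped BigOperators InnerProductSpace Topology
open Filter Classical
open Literature.MathematicalPhysics.StatisticalMechanics Literature.Geometry.DiscreteGeometry
open Summit.AtomisticToContinuum.Crystallization.Theses.ReggeStarCoercivity
open Summit.AtomisticToContinuum.Crystallization.Theorems.DefectFreeCrystallizes.Negative.PredicateAPI (Good defects)

namespace Summit.AtomisticToContinuum.Crystallization.Cruxes.DefectFreeCrystallizes.OctetCellSqueeze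

local notation "E3" => EuclideanSpace ℝ (Fin 3)

/-! ### Objects of the line (transparent definitions over tree declarations) -/

/-- The six vertices `± (a/√2) e_k` of the regular octahedron of edge `a` centred at `0`; antipodal pairs are
`(0,1), (2,3), (4,5)` (the three diagonals). -/
def octVertex (a : ℝ) : Fin 6 → E3 :=
  ![ (a / Real.sqrt 2) • EuclideanSpace.single (0 : Fin 3) (1 : ℝ),
    -((a / Real.sqrt 2) • EuclideanSpace.single (0 : Fin 3) (1 : ℝ)),
     (a / Real.sqrt 2) • EuclideanSpace.single (1 : Fin 3) (1 : ℝ),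
    -((a / Real.sqrt 2) • EuclideanSpace.single (1 : Fin 3) (1 : ℝ)),
     (a / Real.sqrt 2) • EuclideanSpace.single (2 : Fin 3) (1 : ℝ),
    -((a / Real.sqrt 2) • EuclideanSpace.single (2 : Fin 3) (1 : ℝ)) ]

/-- The antipodal vertex label: `0 ↔ 1`, `2 ↔ 3`, `4 ↔ 5`. -/
def antipode : Fin 6 → Fin 6 := ![1, 0, 3, 2, 5, 4]

/-- THE OCTAHEDRAL CELL FUNCTIONAL: all 15 vertex pairs with weight `1/2` (each of the 12 edges is a
nearest-neighbour bond bordering exactly two octahedra of the tet/oct complex) plus an extra `1/2` on the three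
diagonals (second-neighbour bonds, interior to exactly one octahedron).  Summed over the octahedra of any Barlow
stacking this is the bond energy out to `√2·a`; tetrahedra carry nothing. -/
def PhiOct (p : Fin 6 → E3) : ℝ :=
  (1 / 2) * (∑ i : Fin 6, ∑ j ∈ Finset.Ioi i, lennardJones (dist (p i) (p j))) +
  (1 / 2) * (lennardJones (dist (p 0) (p 1)) + lennardJones (dist (p 2) (p 3)) +
    lennardJones (dist (p 4) (p 5)))

/-- `v` is a NON-AFFINE field along the six points `q`: orthogonal to every affine velocity field
`i ↦ A (q i) + b`. -/
def IsNonAffine (q v : Fin 6 → E3) : Prop :=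
  ∀ (A : E3 →ₗ[ℝ] E3) (b : E3), ∑ i : Fin 6, ⟪v i, A (q i) + b⟫_ℝ = 0

/-- The affinely strained cell `i ↦ a • (1 + E) (octVertex 1 i)` (scale `a`, small linear part `E`). -/
def strainedCell (a : ℝ) (E : E3 →L[ℝ] E3) : Fin 6 → E3 :=
  fun i => a • (octVertex 1 i + E (octVertex 1 i))

/-- The metric (Gram operator) `GᵀG` of a cell map. -/
def gram (G : E3 →L[ℝ] E3) : E3 →L[ℝ] E3 := (ContinuousLinearMap.adjoint G).comp G

/-- THE BAND of admissible cell maps: singular values in `[17/20, 6/5]` (radial pinning `[19a/20, 21a/20]`,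
`a ∈ [9/10, 11/10]`, cutoff `6/5`; contains the strain-blindness window `[19/21, 21/19]` of `Negative.StrainBlindness`). -/
def InBand (G : E3 →L[ℝ] E3) : Prop :=
  ∀ u : E3, (17 / 20) * ‖u‖ ≤ ‖G u‖ ∧ ‖G u‖ ≤ (6 / 5) * ‖u‖

/-- NEAR-CONFORMAL cell maps: the metric is within `1/5` (relative, operator norm) of a scalar — anisotropy of a
good shell's own strain is `≤ 0.11` per mechanism (`Negative.StrainBlindness`: uniaxial `[−2/21, 2/19]`; Disproof
numerics: shears `≤ 0.112`), the allowance `1/5` is twice that. -/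
def NearConformal (G : E3 →L[ℝ] E3) : Prop :=
  ∃ c : ℝ, ‖gram G - c • ContinuousLinearMap.id ℝ E3‖ ≤ c / 5

/-- A 6-tuple of particles READS AS A CELL: an affine image `z + G (octVertex 1 ·)` of the unit regular octahedron
with `G` in the band and near-conformal, plus a non-affine residual of `ℓ²`-size at most `‖G‖/10` (kit j006414:
worst admissible `0.098` at `‖G‖ ≈ 1.08`, realised by isotropic expansion with all six vertex scales at the cap). -/
def CellReading (p : Fin 6 → E3) : Prop :=
  ∃ (G : E3 →L[ℝ] E3) (z : E3) (v : Fin 6 → E3), InBand G ∧ NearConformal G ∧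
    IsNonAffine (fun k => z + G (octVertex 1 k)) v ∧
    ∑ k : Fin 6, ‖v k‖ ^ 2 ≤ (‖G‖ / 10) ^ 2 ∧ ∀ k, p k = z + G (octVertex 1 k) + v k

/-- Ideal layer spacing `√(2/3)` of the reference close packing with nearest-neighbour distance `1`. -/
def hIdeal : ℝ := Real.sqrt (2 / 3)

/-- SITE ENERGY of the affine image under `G` of the Barlow stacking with Hägg word `s` (reference spacings
`a = 1`, `h = √(2/3)`), at the site `barlowPos 1 hIdeal s m 0 0` of layer `m`: half the sum of `V_LJ ‖G (p − x)‖`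
over the other points (a `tsum`; absolutely summable for `G` in the band). -/
def siteE (G : E3 →L[ℝ] E3) (s : ℤ → ℤ) (m : ℤ) : ℝ :=
  (1 / 2) * ∑' p : {p : E3 // p ∈ barlowStacking 1 hIdeal s ∧ p ≠ barlowPos 1 hIdeal s m 0 0},
    lennardJones ‖G (p.1 - barlowPos 1 hIdeal s m 0 0)‖

/-- THE STRAIN LANDSCAPE `W(G)`: energy per particle of the affinely strained hcp crystal `G · hcpStacking 1 hIdeal`
(both hcp sublattices have the same site energy under any affine map, by the inversion symmetry of hcp). -/
def W (G : E3 →L[ℝ] E3) : ℝ := siteE G alternatingHagg 0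

/-- Self-energy of the part of a finite configuration inside the closed ball `B(c, R)` (pairs with both ends inside). -/
def windowSelfEnergy {N : ℕ} (x : Fin N → E3) (c : E3) (R : ℝ) : ℝ :=
  ∑ i : Fin N, ∑ j ∈ Finset.Ioi i,
    if dist (x i) c ≤ R ∧ dist (x j) c ≤ R then lennardJones (dist (x i) (x j)) else 0

/-! ### The seven statements of the line -/

/-- STATEMENT 1 — OCTAHEDRON COERCIVITY, TWO REGIMES (cell certificate, PINNED constants).
(a) INNER: for scales `a ∈ [19/20, 1]` and linear parts `‖E‖ ≤ 1/50`, every non-affine perturbation `v` of the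
strained cell with `Σ‖v i‖² ≤ (a/9)²` raises `PhiOct` by at least `1 · Σ‖v i‖²`.  No linear term at ANY affine
cell (centrosymmetric vertex set ⇒ odd fields are linear).  Numerics (folder `calc/octa.py`, reproducing kit
j005718, Disproof `calc/octa.py`, triage-3): reduced Hessian `{3,9}`@1, `{4.759,15.729}`@a*, `{6.695,23.344}`@0.95;
worst nonlinear gain ratio on the typed tube `1.11` (corner `a = 1`, `E = +I/50`), `≥ 1.98` at `a*`.
(b) OUTER HAND-OVER: for every band minimiser `G₀` of `W`, every band, near-conformal `G`, every orientation `R`,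
every non-affine `v` with `Σ‖v k‖² ≤ (‖G‖/10)²`, every Hägg word `s` and layer `m`:
`PhiOct(G R q) ≤ PhiOct(G R q + v) + ½ (siteE G s m − W G₀)` — the non-affine DEFICIT of an admissible cell is at
most half the landscape slack at the same strain (`calc/handover.py`, `orient_opt.py`: deficit `0` up to 12.5 %
anisotropy and edge `1.107`; worst deficit/slack found `0.29` at 20 % basal-shear anisotropy, orientation-optimised;
dilated cells: `≤ 0.02`).  Certified content: interval bounds of the reduced Hessian + cubic remainder on (a)'s tube
(or a Positivstellensatz certificate after `u = r⁻²`), an explicit deficit envelope on the near-conformal band, and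
the lattice-sum lower bounds of Statement 2. -/
def OctahedronCoercivity : Prop :=
  (∀ a : ℝ, 19 / 20 ≤ a → a ≤ 1 → ∀ E : E3 →L[ℝ] E3, ‖E‖ ≤ 1 / 50 →
    ∀ v : Fin 6 → E3, IsNonAffine (strainedCell a E) v → ∑ i : Fin 6, ‖v i‖ ^ 2 ≤ (a / 9) ^ 2 →
      PhiOct (strainedCell a E) + ∑ i : Fin 6, ‖v i‖ ^ 2 ≤ PhiOct (fun i => strainedCell a E i + v i)) ∧
  (∀ G₀ : E3 →L[ℝ] E3, InBand G₀ → IsMinOn W {G | InBand G} G₀ →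
    ∀ G : E3 →L[ℝ] E3, InBand G → NearConformal G → ∀ R : E3 →ₗᵢ[ℝ] E3,
      ∀ v : Fin 6 → E3, IsNonAffine (fun k => G (R (octVertex 1 k))) v →
        ∑ k : Fin 6, ‖v k‖ ^ 2 ≤ (‖G‖ / 10) ^ 2 →
        ∀ s : ℤ → ℤ, IsHaggSeq s → ∀ m : ℤ,
          PhiOct (fun k => G (R (octVertex 1 k))) ≤
            PhiOct (fun k => G (R (octVertex 1 k)) + v k) + (1 / 2) * (siteE G s m - W G₀))

/-- STATEMENT 2 — BAND LANDSCAPE (relaxed hcp is the sitewise floor of every affinely strained Barlow stacking, with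
PINNED two-regime growth): there is a band map `G₀` (the relaxed hcp, `a* = 0.9713`, `h*/a* = 0.8164`,
`W G₀ = −0.71759`), realised by a genuine periodic configuration (so `⨅ periodic ≤ W G₀`), such that for EVERY band
`G`, EVERY Hägg word `s` and EVERY layer `m` the site energy satisfies
`siteE G s m ≥ W G₀ + (3/4)·min(‖GᵀG − G₀ᵀG₀‖², 6/1000)`.  In particular `G₀` minimises `W` on the band (take
`s = alternatingHagg`).  Numerics (`calc/band.py`, `registry_scan.py`, cutoff 11, tail-corrected): 0 violations
over 2637 in-band (strain, word) pairs incl. fcc±, single c-layers, twins, basal shears to 25 % in the hole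
direction, uniaxial/biaxial corners; worst ratio `1.48` (3 % combined strain + favourable-shear word), `2.0` for
small basal shear (curvature `1.34 γ²`), `1.57` for in-plane uniaxial stretch `4 %`; far corners trivial (slack
`≥ 0.08`).  The gen-1 global modulus `½‖ΔC‖²` FAILS at the in-plane uniaxial corner (`0.107 < 0.123`) — hence the
cap.  Size L: 6-dim certified lattice sums × finitely many near words + `k⁻⁴` layer tail + the sitewise
earliest-return majorisation (`J_k ≤ 0`, `|J_k|` antitone) for arbitrary words; the tsum regrouping behind
`e(Q₀) = W G₀` (both hcp sublattices have equal site energy under any linear map, by inversion symmetry). -/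
def BandLandscape : Prop :=
  ∃ G₀ : E3 →L[ℝ] E3, InBand G₀ ∧
    (∃ Q : PeriodicConfiguration 3, Q.points = (fun p => G₀ p) '' hcpStacking 1 hIdeal ∧
      Q.energyPerParticle lennardJones = W G₀) ∧
    ∀ G : E3 →L[ℝ] E3, InBand G → ∀ s : ℤ → ℤ, IsHaggSeq s → ∀ m : ℤ,
      W G₀ + (3 / 4) * min (‖gram G - gram G₀‖ ^ 2) (6 / 1000) ≤ siteE G s m

/-- STATEMENT 3 — REGISTRY GAP (sitewise earliest return at every strain within `3 %` of the relaxed cell, PINNED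
gap `10⁻⁵` ON TOP of the quadratic strain slack): for every band minimiser `G₀` of `W`, every `G` with
`‖G − G₀‖ ≤ 3/100`, every Hägg word `s` and layer `m` whose site SEES a cubic registry relation (layer `m` not
aligned with `m + 2` or not with `m − 2`): `siteE G s m ≥ W G₀ + (3/4)‖GᵀG − G₀ᵀG₀‖² + 10⁻⁵`.  Numerics
(`calc/registry.py`, `registry_scan.py`): at `G₀` a one-sided cubic-sighted site pays `½|J₂| − ½|J₃| = 3.68e-5`
(margin `3.7×`), fcc/twin sites `7.4e-5`; under basal shear `γ` in the hole direction the k = 1 layer coupling is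
word-dependent at third order (`≈ 5.9 (γh)³` per site, D₃ invariant `Re ε³`; the first order vanishes — triage r1-3,
gen-1 `registry_shear2`) and is dominated by the elastic `1.34 γ²` for `γ ≲ 0.4`, so the worst ratio on the tube
is `2.6` (at `γ = 0.005`); `J₂ < 0` on the whole tube (triage-2 `dJ2.py`: `J₂ ∈ [−2.0e-4, −1.6e-5]` on a much
larger box).  Size M–L (certified layer sums on a 6-dim tube × finitely many layer distances + `k⁻⁴` tail; the
row-wise combinatorial majorisation — k-th return ≥ 2k, ≥ 2k+1 once the first return is missed — is S). -/
def RegistryGap : Prop :=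
  ∀ G₀ : E3 →L[ℝ] E3, InBand G₀ → IsMinOn W {G | InBand G} G₀ →
    ∀ G : E3 →L[ℝ] E3, ‖G - G₀‖ ≤ 3 / 100 →
      ∀ s : ℤ → ℤ, IsHaggSeq s → ∀ m : ℤ, ¬ (HaggAligned s m 2 ∧ HaggAligned s (m - 2) 2) →
        W G₀ + (3 / 4) * ‖gram G - gram G₀‖ ^ 2 + 1 / 100000 ≤ siteE G s m

/-- STATEMENT 4 — LOCAL CELL COMPLEX (finite geometry; existence of ONE consistent cell family — what the squeeze
consumes — instead of gen-1's uniqueness over all readings, which the 36 bond-midpoint lattice octahedra of fcc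
(anisotropy `2`) make a quantitative hostage): for every injective configuration there is a finite family `𝒪` of
labelled 6-tuples such that every member READS AS A CELL (band, near-conformal, non-affinity `≤ ‖G‖/10`), no two
members share their vertex set, no two members share a diagonal pair, and around every site `i` whose
`12/5`-neighbourhood is good (crux predicate verbatim via `PredicateAPI.Good`): exactly six members contain `i`;
in each of them the vertex antipodal to `i` lies beyond `6/5` and the four others within `6/5` of `x i`; and every
first neighbour `j` of `i` (within `6/5`) lies, non-antipodally to `i`, in exactly two members.  Hence on a good
region `Σ_{𝒪} PhiOct` counts every nearest-neighbour bond with weight `½ + ½` and every diagonal pair once.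
Inputs: radial pinning (`Good.exists_annulus`), twelve neighbours exactly (`Good.card_nbrs_eq`), type of a site
(`Negative.TypeGap`), frame pinning `≈ 6°` (Disproof numerics), each pattern vertex on exactly 2 squares
(cuboctahedron 3.4.3.4, anticuboctahedron 3².4² / 3.4.3.4), the card's adversarial NLP (kit j006414: worst `ℓ²`
non-affinity `0.098` at `‖G‖ ≈ 1.08`, margin 9 %; un-run adversary: mixed fcc/hcp vertex types with the 13th-point
exclusion — the lead should run it first), and `calc/cells_enum.py` (exact fcc/hcp: the only centrally symmetric
6-subsets through a site with largest semi-axis in band are the six standard octahedra; the next family has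
singular values `(0.707, 1, 1.414)·d`, residual budget needed `≥ 0.05` vs allowed `0.0144`). -/
def LocalCellComplex : Prop :=
  ∀ (N : ℕ) (x : Fin N → E3), Function.Injective x →
    ∃ 𝒪 : Finset (Fin 6 → Fin N),
      (∀ o ∈ 𝒪, Function.Injective o ∧ CellReading (fun k => x (o k))) ∧
      (∀ o ∈ 𝒪, ∀ o' ∈ 𝒪, Set.range o = Set.range o' → o = o') ∧
      (∀ o ∈ 𝒪, ∀ o' ∈ 𝒪, ∀ k k' : Fin 6, o k = o' k' → o (antipode k) = o' (antipode k') → o = o') ∧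
      ∀ i : Fin N, (∀ j : Fin N, dist (x i) (x j) ≤ 12 / 5 → Good x j) →
        (𝒪.filter fun o => i ∈ Set.range o).card = 6 ∧
        (∀ o ∈ 𝒪, ∀ k : Fin 6, o k = i →
          6 / 5 < dist (x i) (x (o (antipode k))) ∧
          ∀ k' : Fin 6, k' ≠ k → k' ≠ antipode k → dist (x i) (x (o k')) ≤ 6 / 5) ∧
        (∀ j : Fin N, j ≠ i → dist (x i) (x j) ≤ 6 / 5 →
          (𝒪.filter fun o => ∃ k k' : Fin 6, o k = i ∧ o k' = j ∧ k' ≠ antipode k).card = 2)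

/-- STATEMENT 5 — WINDOW PINNING, UPPER HALF (cut-and-paste; exact minimality is used HERE): for every fixed
periodic trial configuration `Q` there is `C_Q` such that every window `B(c, R)` of every Lennard-Jones ground
state has self-energy at most `(#particles in it) · e(Q) + C_Q R²`.  Proof route: `E(N) ≤ E(N − n) + E(n)`
(far-away cluster), `E(N − n) ≤ E(x minus window) = E(N) − self − cross`, `−cross ≤ C R²` by the `1/3`-separation
of ground states (`LennardJonesMinimalDistance_holds`) and the summable `r⁻⁶` tail, and the trial bound
`E(n) ≤ n e(Q) + C'_Q n^{2/3}` (the `n` points of `Q` nearest a centre: motif classes balanced up to `O(n^{2/3})`)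
with `n ≤ C R³`.  Sign-consistent in every regime (bulk, surface cap, whole cluster `R ≳ N^{1/3}`, `e(Q) ≥ 0`).
Stated for EVERY `Q` (the line uses `Q = G₀ · hcp` of Statement 2). -/
def WindowPinning : Prop :=
  ∀ Q : PeriodicConfiguration 3, ∃ C : ℝ, ∀ (N : ℕ) (x : Fin N → E3), IsGroundState lennardJones x →
    ∀ (c : E3) (R : ℝ), 1 ≤ R →
      windowSelfEnergy x c R ≤
        (Nat.card {i : Fin N // dist (x i) c ≤ R} : ℝ) * Q.energyPerParticle lennardJones + C * R ^ 2

/-- THE TRANSFER TARGET `C⁺` (finite-`N`, deterministic, uniform in `N`) — EXACT STRAINED-HCP SUB-WINDOWS: there is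
ONE band map `G₀` such that for all `ε, r > 0` some radius `R ≥ r` works: whenever a Lennard-Jones ground state has
a particle within `1` of a centre `c` and ALL its particles within `R + 3` of `c` are good, some sub-ball
`B(c', r) ⊆ B(c, R)` is two-way `ε`-matched with a rigid image `A ∘ G₀ + t` of `hcpStacking 1 hIdeal`.
Stronger than what the crux needs (it names hcp and exactness) and closed under the re-limits the squeeze uses;
no `Good` predicate is ever passed to a limit (Disproof §3 trap avoided by construction). -/
def SqueezeWindow : Prop :=
  ∃ G₀ : E3 →L[ℝ] E3, InBand G₀ ∧
    ∀ ε r : ℝ, 0 < ε → 0 < r → ∃ R : ℝ, r ≤ R ∧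
      ∀ (N : ℕ) (x : Fin N → E3), IsGroundState lennardJones x →
        ∀ c : E3, (∃ j : Fin N, dist (x j) c ≤ 1) → (∀ j : Fin N, dist (x j) c ≤ R + 3 → Good x j) →
          ∃ (c' : E3) (A : E3 →ₗᵢ[ℝ] E3) (t : E3), dist c' c + r ≤ R ∧
            BallMatch ε r c' (Set.range x) ((fun p => A (G₀ p) + t) '' hcpStacking 1 hIdeal)

/-- STATEMENT 6 — THE SQUEEZE (the analysis; hardest stub): Statements 1–5 imply `SqueezeWindow`.  Route: by
Statement 4 the cell family exists on `B(c, R + 1)` and `Σ_𝒪 PhiOct` = bond energy out to the diagonals, each pair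
counted once; far bonds are compared with the cellwise affine reference along nearest-neighbour paths
(Cauchy–Schwarz; negative-curvature weight `(1/12) Σ_{r ≥ √(8/3)a} n_r r² |V″| = 1.19` per step for BOTH site
types, triage r1-2 (a), against the pinned constant `2 · 1` of Statement 1(a) and the local growth `3/4` of
Statement 2), the telescoped linear terms leave a boundary flux `O(R² · max dev)` (triage r1-3 (b)(c); references
are local, `dev ≤ ‖G‖/10`; hcp sublattices paired); per cell, Statement 1(a) (inner tube) or 1(b) (deficit ≤ half
the slack) plus Statement 2 (all words, whole band) give a non-negative slack
`≥ ½·(3/4)·min(‖ΔC_c‖², 6/1000) + [inner] dev_c²`, and Statement 3 adds `10⁻⁵` per cubic-sighted site on the 3 %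
tube; with Statement 5 at `Q = Q₀` and `⨅ ≤ e(Q₀) = W G₀`: `Σ_cells slack_c + 10⁻⁵ · #cubic-sighted ≤ C' R²`;
Chebyshev picks `B(c', r)` with slack `≤ C' r³ / R`, and small slack ⇒ (chaining of frames across shared faces,
rotation drift `≤ r·ε`) `ε`-closeness to ONE rigid image of `G₀ · hcp`. -/
def Squeeze : Prop :=
  OctahedronCoercivity → BandLandscape → RegistryGap → LocalCellComplex → WindowPinning → SqueezeWindow

/-- STATEMENT 7 — TRANSFER (`C⁺ ⇒` crux; provable now, M): `SqueezeWindow` and zero defect density give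
`IsCrystallizing lennardJones 3`.  Route: ground states are `1/3`-separated, so a defective particle spoils the
`(R + 3)`-balls of at most `C_R` centres; `defects = o(N)` leaves an unspoiled centre `c = x i` for `N` large;
`SqueezeWindow` at `(ε, r) = (1/k, k)` gives windows with rotations `A_k ∈ O(3)` (compact): along a subsequence
`A_k → A_∞`, so on every FIXED ball the translated ground states are eventually two-way matched with the FIXED
point set `A_∞ G₀ · hcp`; this is the point set of a periodic configuration (linear image of
`hcpPeriodicConfiguration`, `G₀` invertible by `InBand`), and `PeriodicConfiguration.tendsto_sum_of_eventually_near'`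
with the separation gives the local convergence with multiplicity `1` (= the hull criterion, HullMinimality 3243). -/
def Transfer : Prop :=
  SqueezeWindow → ZeroDefectDensity → IsCrystallizing lennardJones 3

/-! ### Registered stubs (the ONLY `sorry`s of the file) -/

/-- STUB 1 — cell certificate, inner tube + outer hand-over (Statement 1). -/
theorem stub_octahedronCoercivity : OctahedronCoercivity := by
  sorry

/-- STUB 2 — band landscape: relaxed hcp is the sitewise floor, two-regime growth, all words (Statement 2). -/
theorem stub_bandLandscape : BandLandscape := by
  sorry

/-- STUB 3 — registry gap on the 3 % tube for cubic-sighted sites (Statement 3). -/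
theorem stub_registryGap : RegistryGap := by
  sorry

/-- STUB 4 — the consistent local cell family around good sites (Statement 4). -/
theorem stub_localCellComplex : LocalCellComplex := by
  sorry

/-- STUB 5 — one-sided window pinning against a fixed periodic trial configuration (Statement 5). -/
theorem stub_windowPinning : WindowPinning := by
  sorry

/-- STUB 6 — the squeeze: five inputs ⇒ exact strained-hcp sub-windows (Statement 6; hardest). -/
theorem stub_squeeze : Squeeze := by
  sorry

/-- STUB 7 — transfer: sub-windows + zero defect density ⇒ `IsCrystallizing` (Statement 7). -/
theorem stub_transfer : Transfer := by
  sorry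

/-! ### Name-keyed aliases of the seven statements (hypotheses of the composition)

`__Registered.stub_X` is statement `X` under the registered stub's short name, so that the native skeleton audit
(`#h21_check_skeleton`: hypotheses admissible iff registered obligations / declared stubs BY NAME) accepts
`DefectFreeCrystallizes_of : __Registered.stub_… → … → DefectFreeCrystallizes` (device of
`Cruxes/LoopsToCrossings/Lines/br-sandwich-diagonal.lean`, kept from gen 1); `defectFreeCrystallizes_skeleton`
applies the composition to the seven `stub_…` literally, which checks that statements, aliases and stubs agree. -/
namespace __Registered

/-- Alias of `OctahedronCoercivity` keyed by the registered stub name. -/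
abbrev stub_octahedronCoercivity : Prop := OctahedronCoercivity
/-- Alias of `BandLandscape` keyed by the registered stub name. -/
abbrev stub_bandLandscape : Prop := BandLandscape
/-- Alias of `RegistryGap` keyed by the registered stub name. -/
abbrev stub_registryGap : Prop := RegistryGap
/-- Alias of `LocalCellComplex` keyed by the registered stub name. -/
abbrev stub_localCellComplex : Prop := LocalCellComplex
/-- Alias of `WindowPinning` keyed by the registered stub name. -/
abbrev stub_windowPinning : Prop := WindowPinning
/-- Alias of `Squeeze` keyed by the registered stub name. -/
abbrev stub_squeeze : Prop := Squeeze
/-- Alias of `Transfer` keyed by the registered stub name. -/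
abbrev stub_transfer : Prop := Transfer

end __Registered

/-! ### The composition (kernel-checked, no `sorry`) -/

/-- **`DefectFreeCrystallizes` from the seven stubs.**  The crux is literally
`ZeroDefectDensity → IsCrystallizing lennardJones 3` (`Disproof.crux_iff` is `Iff.rfl`): the five certified /
finite / pinning inputs feed the squeeze, whose exact strained-hcp sub-windows the transfer turns, together with
the crux hypothesis, into Blanc–Lewin local convergence. -/
theorem DefectFreeCrystallizes_of (h₁ : __Registered.stub_octahedronCoercivity)
    (h₂ : __Registered.stub_bandLandscape) (h₃ : __Registered.stub_registryGap)
    (h₄ : __Registered.stub_localCellComplex) (h₅ : __Registered.stub_windowPinning)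
    (h₆ : __Registered.stub_squeeze) (h₇ : __Registered.stub_transfer) :
    Summit.AtomisticToContinuum.Crystallization.Theses.ReggeStarCoercivity.DefectFreeCrystallizes := by
  intro hZ
  exact h₇ (h₆ h₁ h₂ h₃ h₄ h₅) hZ

/-- The crux from the registered stubs (the lead's closing theorem: sorry-free once every `stub_*` is replaced
by its landed helper; its type is literally the route decl). -/
theorem defectFreeCrystallizes_skeleton :
    Summit.AtomisticToContinuum.Crystallization.Theses.ReggeStarCoercivity.DefectFreeCrystallizes :=
  DefectFreeCrystallizes_of stub_octahedronCoercivity stub_bandLandscape stub_registryGap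
    stub_localCellComplex stub_windowPinning stub_squeeze stub_transfer

end Summit.AtomisticToContinuum.Crystallization.Cruxes.DefectFreeCrystallizes.OctetCellSqueeze

end
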